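import Summits.AtomisticToContinuum.Crystallization.Theorems.PricedLinkCensusLocalToGlobalZeroChargeBulkOfQcg
import Summits.AtomisticToContinuum.Crystallization.Theorems.PricedLinkCensusLayeringGlue
import Summits.AtomisticToContinuum.Crystallization.Theorems.PricedLinkCensusChargedPeriodicIsOptimal
import Summits.AtomisticToContinuum.Crystallization.Theorems.PalmUnimodularRigidityChargedPatternCrystallizes

/-!
# Route `PricedLinkCensus` closes from the QUALITATIVE PHASE GAP: `Crystallization` from
# `QualitativeChargeGapWith (1/100)`, `SoftLayerPropagation` and `StackingHinge`

Line `phase-gap-rate-upgrade` of the crux `LocalToGlobal` (stmt-AtomisticToContinuum-14232), lead c12.  The route's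
deciding theorem `closes` (Theses/PricedLinkCensus.lean) uses its two census binders `(hT : TruncatedCensusGap)`,
`(hLG : LocalToGlobal)` ONLY as `hGC (hLG hT) hUB`, i.e. to obtain `ZeroChargeBulk` and the energy limit
`E(N)/N → ⨅ e` from the priced gap `ChargedEnergyGap`.  Both are available WITHOUT any priced gap:

* `ZeroChargeBulk` from the qualitative phase gap Sub₁ alone — `zeroChargeBulk_of_qualitativeChargeGap`
  (`Theorems/PricedLinkCensusLocalToGlobalZeroChargeBulkOfQcg.lean`, this line);
* the energy limit unconditionally — `ChargedEnergyGapNegative.crysEnergyLimit` (item 0626, proved by periodisation).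

Hence the whole route closes from THREE open statements, none of which is a priced gap:

  `crystallization_of_qualitativeChargeGap :
      QualitativeChargeGapWith (1/100) → SoftLayerPropagation → StackingHinge → Crystallization`

(the other binders of `closes` are discharged by the landed proofs `layeringGlue_proof` (14237),
`chargedPatternCrystallizes_proof` (2916, stated on route PalmUnimodularRigidity's verbatim copy of the decl — the two
`def`s agree definitionally), `chargedPeriodicIsOptimal_proof` (2913), and the Literature discharges
`LennardJonesMinimalDistance_holds`, `LennardJonesGroundStatesExist_holds`).  This is the kernel-checked form of the
crux-strategist's recommendation (Cruxes/LocalToGlobal/STRATEGY-CENSUS.md §6.1: re-glue `closes` on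
`(hQ : QualitativeChargeGap)`); the tenure planner can re-point the deciding theorem at it.  The same with the lead's
registered open stub, the PERIODIC phase gap: `crystallization_of_periodicPhaseGap`.  All `[folklore]` (composition of
landed results).
-/

noncomputable section

namespace Summit.AtomisticToContinuum.Crystallization.Theorems.PricedLinkCensusLocalToGlobalPhaseGap

open Literature.MathematicalPhysics.StatisticalMechanics
open Literature.Geometry.DiscreteGeometry
open Summit.AtomisticToContinuum.Crystallization.Theses.PricedLinkCensus
open Summit.AtomisticToContinuum.Crystallization.Theorems.ChargedEnergyGapNegative
open Filter Topology

/-- Item 2916 `ChargedPatternCrystallizes` in THIS route's namespace, from the landed proof of its verbatim twin on route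
`PalmUnimodularRigidity` (the two route files declare the same term; Lean checks the definitional agreement). [folklore] -/
theorem chargedPatternCrystallizes_holds' : ChargedPatternCrystallizes :=
  Summit.AtomisticToContinuum.Crystallization.Theorems.chargedPatternCrystallizes_proof

/-- **The route closes from the qualitative phase gap** (registered on the crux item as the statement this file
proves): `QualitativeChargeGapWith (1/100) → SoftLayerPropagation → StackingHinge → Crystallization`.  Proof = the
body of `closes` with `hZ := zeroChargeBulk_of_qualitativeChargeGap hQ` and `hLim := crysEnergyLimit` in place of
`hGC (hLG hT) hUB`, and the proved items inlined. [folklore] -/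
theorem crystallization_of_qualitativeChargeGap : QualitativeChargeGapWith (1 / 100) → SoftLayerPropagation → StackingHinge → _root_.Crystallization := by
  intro hQ hSLP hSH
  -- zero charge in the bulk from the phase gap alone; the energy limit is unconditional
  have hZ : ZeroChargeBulk := zeroChargeBulk_of_qualitativeChargeGap hQ
  have hLim : Tendsto (fun N : ℕ => groundStateEnergy lennardJones 3 N / N) atTop
      (𝓝 (⨅ Q : PeriodicConfiguration 3, Q.energyPerParticle lennardJones)) := crysEnergyLimit
  -- zero charge ⇒ charge-free windows (LayeringGlue, proved) ⇒ with soft layer propagation the hinge charges one Q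
  have hGSCP : GroundStatesChargePeriodic :=
    hSH hSLP (Summit.AtomisticToContinuum.Crystallization.Theorems.layeringGlue_proof hZ)
  refine ⟨?_, chargedPatternCrystallizes_holds' hGSCP LennardJonesMinimalDistance_holds⟩
  -- conjunct (i): charge some Q along an actual sequence of ground states; that Q is optimal (2913, proved)
  choose x hx using LennardJonesGroundStatesExist_holds
  obtain ⟨Q, hQx⟩ := hGSCP x hx
  have hleast := Summit.AtomisticToContinuum.Crystallization.Theorems.chargedPeriodicIsOptimal_proof Q ⟨x, hx, hQx⟩
  refine ⟨Q, hleast, ?_⟩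
  have h : (⨅ Q : PeriodicConfiguration 3, Q.energyPerParticle lennardJones) =
      Q.energyPerParticle lennardJones := hleast.csInf_eq
  rwa [h] at hLim

/-- The same from the lead's registered open stub of the line, the PERIODIC phase gap
(`PeriodicPhaseGapWith (1/100)`; it implies Sub₁ by far periodisation, `qualitativeChargeGap_of_periodicPhaseGap`).
[folklore] -/
theorem crystallization_of_periodicPhaseGap (hP : PeriodicPhaseGapWith (1 / 100)) (hSLP : SoftLayerPropagation)
    (hSH : StackingHinge) : _root_.Crystallization :=
  crystallization_of_qualitativeChargeGap (qualitativeChargeGap_of_periodicPhaseGap (by norm_num) hP) hSLP hSH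

/-- And, for the record, from the sibling crux `ChargedEnergyGap` (stmt-AtomisticToContinuum-14231) — which is how the
current `closes` reads once `hLG hT` is formed: the census cruxes `TruncatedCensusGap` / `LocalToGlobal` enter the
route only through this implication. [folklore] -/
theorem crystallization_of_chargedEnergyGap (h : ChargedEnergyGap) (hSLP : SoftLayerPropagation)
    (hSH : StackingHinge) : _root_.Crystallization :=
  crystallization_of_qualitativeChargeGap (qualitativeChargeGap_of_chargedEnergyGap h) hSLP hSH

/-! ## The minimal form: the route closes from its TARGET item

`closes` never uses the priced gap after forming `hZ : ZeroChargeBulk`; so ANY proof of the target item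
`ZeroChargeBulk` (stmt-AtomisticToContinuum-14229) — by census, by phase gap, or otherwise — closes the route together with
the two geometric cruxes.  Recorded explicitly (registered on the crux item as the statement this revision adds). -/

/-- **The route closes from its target**: `ZeroChargeBulk → SoftLayerPropagation → StackingHinge → Crystallization`
(tail of the body of `closes`, with the energy limit `crysEnergyLimit` and the proved items `layeringGlue_proof`,
`chargedPatternCrystallizes_proof`, `chargedPeriodicIsOptimal_proof`, `LennardJonesMinimalDistance_holds`,
`LennardJonesGroundStatesExist_holds` inlined). [folklore] -/
theorem crystallization_of_zeroChargeBulk : ZeroChargeBulk → SoftLayerPropagation → StackingHinge → _root_.Crystallization := by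
  intro hZ hSLP hSH
  have hLim : Tendsto (fun N : ℕ => groundStateEnergy lennardJones 3 N / N) atTop
      (𝓝 (⨅ Q : PeriodicConfiguration 3, Q.energyPerParticle lennardJones)) := crysEnergyLimit
  have hGSCP : GroundStatesChargePeriodic :=
    hSH hSLP (Summit.AtomisticToContinuum.Crystallization.Theorems.layeringGlue_proof hZ)
  refine ⟨?_, chargedPatternCrystallizes_holds' hGSCP LennardJonesMinimalDistance_holds⟩
  choose x hx using LennardJonesGroundStatesExist_holds
  obtain ⟨Q, hQx⟩ := hGSCP x hx
  have hleast := Summit.AtomisticToContinuum.Crystallization.Theorems.chargedPeriodicIsOptimal_proof Q ⟨x, hx, hQx⟩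
  refine ⟨Q, hleast, ?_⟩
  have h : (⨅ Q : PeriodicConfiguration 3, Q.energyPerParticle lennardJones) =
      Q.energyPerParticle lennardJones := hleast.csInf_eq
  rwa [h] at hLim

/-- `crystallization_of_qualitativeChargeGap` factors through the target (same proof term up to
`zeroChargeBulk_of_qualitativeChargeGap`). [folklore] -/
theorem crystallization_of_qualitativeChargeGap' (hQ : QualitativeChargeGapWith (1 / 100)) (hSLP : SoftLayerPropagation)
    (hSH : StackingHinge) : _root_.Crystallization :=
  crystallization_of_zeroChargeBulk (zeroChargeBulk_of_qualitativeChargeGap hQ) hSLP hSH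

end Summit.AtomisticToContinuum.Crystallization.Theorems.PricedLinkCensusLocalToGlobalPhaseGap

end
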